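import Literature.NumberTheory.Automorphic.TorusMeasureTowerTransportProd
import Literature.NumberTheory.Automorphic.StableCentralizerEquivComponentwise
import Literature.NumberTheory.Automorphic.UnitaryGroupOrbitalMeasureOfLocalQuotient
import Literature.NumberTheory.Automorphic.LocalCentralizerUnimodularOfAdelic
import Literature.NumberTheory.Automorphic.OrbitalMeasureCanonical
import Literature.NumberTheory.Rogawski1990.RegularEltLocalisation
import Literature.MeasureTheory.Group.LatticeCovolumeTransport
import HarnessLib

/-!
# Coherence of the adelic torus measures along the stable-centraliser isomorphism of `U(H)`, `U(H′)`
(Rogawski (1990) §4.3 pp. 43–44, §14.5 pp. 237–238: for stably conjugate regular `γ ∈ U(H)(L⁺)`, `γ′ ∈ U(H′)(L⁺)` the tori `T = Z(γ)`,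
`T′ = Z(γ′)` are `L⁺`-isomorphic and their Haar measures `dt = dt_∞ ⊗ ⊗_v dt_v`, `dt′` are fixed COMPATIBLY, so that the weights
`m(T(L⁺) \ T(𝔸))` of the two trace formulas agree)

Topic `NumberTheory/Automorphic`; namespace `Literature.NumberTheory.Automorphic.UnitaryGroup`; THEOREMS ONLY (no definition, no instance, no named
fact).  Registry pub/hodgecm-mathlib F0∕P3a, ENGINE T1 (M-C) «measure coherence», row (O10-b3-δ4-CM) of A-p06 = the (O-W) input «β is constant on
regular stable classes» of ED. 1.19b: the CM dress of ★ `map_torusMeasure_eq_of_componentwise`.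

* §1 `exists_continuousMulEquiv_subgroup_apply_eq` — an isomorphism of topological groups restricts to matching subgroups (∃-form).
* §2 **`UnitaryGroup.map_adelicStableCentralizerEquiv_torusMeasure_eq`** — for rational `γ ↔ γ′` (`γ` regular; `det H, det H′ ≠ 0`) and adelic torus
  measures `t_𝔸` on `Z(γ ⊗ 1)`, `t′_𝔸` on `Z(γ′ ⊗ 1)` given by the EXPRESSIONS of ★ `adelicOrbitalMeasureOfLocal_quotientMeasure_eq` (model iso
  `e = adelicProdEquiv⁻¹`, `t_𝔸 = (e|)_* t_P`, `prodEquiv_* t_P = t_∞ ⊗ t_f`, `t_f` the restricted product of the model-local torus measures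
  `t_v` on `Z((g_f)_v) ≤ U(H)(L⁺_v)`-model `localPi v`): IF (i) every isomorphism of the model-local tori carries `t_v` to `t′_v`
  (hypothesis `hQ` — true for CANONICALLY normalised measures, ★ `map_eq_of_apply_compactCore_eq_one`), (ii) off a finite set the integral
  subgroup `Z ∩ K_v` IS the compact core on both sides (`hK`, `hK′` — ★ F4-a `CompactCoreCentralizerLevelAE` read on the model), (iii) a measurable
  `P_∞ : Z_∞(γ) → Z_∞(γ′)` with `(P_∞)_* t_∞ = t′_∞` IS the archimedean component of `e_𝔸 = adelicStableCentralizerEquiv` (`hPa`; by ★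
  `archPart_adelicStableCentralizerEquiv` this is ★ `archStableCentralizerEquiv`), THEN **`(e_𝔸)_* t_𝔸 = t′_𝔸`**.  The finite components of `e_𝔸`
  are the ★ `localStableCentralizerEquiv` (★ `toLocal_adelicStableCentralizerEquiv`), moved to the model by ★ `cmDatum_toLocal_eq_localPiEquiv`.
* §2 cor. **`UnitaryGroup.covolume_eq_of_map_adelicStableCentralizerEquiv_eq`** — (b2): with ★ `covolume_count_eq_of_mulEquiv'` and ★
  `adelicStableCentralizerEquiv_mem_arithmeticSubgroup_iff`, coherent torus measures give EQUAL COVOLUMES `m(Z_γ(L⁺) \ Z_γ(𝔸))` in the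
  counting-measure currency `(quotientSubgroup ⊓ Z).subgroupOf Z` of ★ `integral_quotientKernel_diag_eq_mul_tsum_covol_cmDatum`.

## References
* J. D. Rogawski, *Automorphic Representations of Unitary Groups in Three Variables* (1990), §4.3 pp. 43–44, §14.5 pp. 237–238 [Rogawski1990].
* S. Gelbart, *Automorphic forms on adele groups* (1975), p. 155 (10.19), Remark 9.23 [Gelbart1975].
-/

set_option autoImplicit false

noncomputable section

open _root_.MeasureTheory _root_.MeasureTheory.Measure Set Filter Function NumberField IsDedekindDomain
open _root_.Topology
open Literature.Topology.RestrictedProduct Literature.Topology.Algebra.RestrictedProduct Literature.MeasureTheory.Group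
open Literature.MeasureTheory.RestrictedProduct Literature.NumberTheory.Rogawski1990
open scoped RestrictedProduct ENNReal NNReal Pointwise Matrix MatrixGroups

namespace Literature.NumberTheory.Automorphic

/-! ## §1 Restricting an isomorphism of topological groups to matching subgroups (∃-form) -/

/-- For `φ : A ≃ₜ* B` and subgroups `S ≤ A`, `T ≤ B` with `φ x ∈ T ↔ x ∈ S`, some `Q : S ≃ₜ* T` has `Q s = φ s`. [cite: Rogawski1990, §4.3 pp. 43–44] -/
theorem exists_continuousMulEquiv_subgroup_apply_eq {A B : Type*} [Group A] [Group B] [TopologicalSpace A] [TopologicalSpace B]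
    (φ : A ≃ₜ* B) (S : Subgroup A) (T : Subgroup B) (h : ∀ x, φ x ∈ T ↔ x ∈ S) :
    ∃ Q : S ≃ₜ* T, ∀ s : S, ((Q s : T) : B) = φ (s : A) := by
  refine ⟨{ toFun := fun s => ⟨φ s, (h s).2 s.2⟩,
             invFun := fun t => ⟨φ.symm t, (h (φ.symm t)).1 (by rw [ContinuousMulEquiv.apply_symm_apply]; exact t.2)⟩,
             left_inv := fun s => Subtype.ext (φ.symm_apply_apply s),
             right_inv := fun t => Subtype.ext (φ.apply_symm_apply t),
             map_mul' := fun s s' => Subtype.ext (map_mul φ (s : A) (s' : A)),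
             continuous_toFun := (φ.continuous.comp continuous_subtype_val).subtype_mk _,
             continuous_invFun := (φ.symm.continuous.comp continuous_subtype_val).subtype_mk _ }, fun s => rfl⟩

/-- An isomorphism of topological groups respects membership in the compact cores (★ `image_compactCore`). [cite: Rogawski1990, §4.3 p. 43] -/
theorem apply_mem_compactCore_iff {Z Z' : Type*} [Group Z] [TopologicalSpace Z] [Group Z'] [TopologicalSpace Z'] (e : Z ≃ₜ* Z') (z : Z) :
    e z ∈ compactCore Z' ↔ z ∈ compactCore Z := by
  rw [← image_compactCore e]
  exact ⟨fun ⟨x, hx, hxz⟩ => e.injective hxz ▸ hx, fun hz => ⟨z, hz, rfl⟩⟩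

namespace UnitaryGroup

variable (L : Type) [Field L] [NumberField L] [IsCMField L] (N : ℕ) (H H' : Matrix (Fin N) (Fin N) L)

/-! ## §2 `(e_𝔸)_* t_𝔸 = t′_𝔸` -/

section Coherence

variable {γ : (cmDatum L N H).Rational} {γ' : (cmDatum L N H').Rational}
  [∀ v, MeasurableSpace (↥(localPi L (IsCMField.complexConj L) N H v))] [∀ v, BorelSpace (↥(localPi L (IsCMField.complexConj L) N H v))] [∀ v, SecondCountableTopology (↥(localPi L (IsCMField.complexConj L) N H v))]
  [BorelSpace (Πʳ v : HeightOneSpectrum (𝓞 ↥(maximalRealSubfield L)), [↥(localPi L (IsCMField.complexConj L) N H v), localInt L (IsCMField.complexConj L) N H v])]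
  [hKc : ∀ v, CompactSpace (localInt L (IsCMField.complexConj L) N H v)]
  [MeasurableSpace (finAdelic (↥(maximalRealSubfield L)) L (IsCMField.complexConj L) N H)] [BorelSpace (finAdelic (↥(maximalRealSubfield L)) L (IsCMField.complexConj L) N H)] [SecondCountableTopology (finAdelic (↥(maximalRealSubfield L)) L (IsCMField.complexConj L) N H)]
  [MeasurableSpace (arch (↥(maximalRealSubfield L)) L (IsCMField.complexConj L) N H)] [BorelSpace (arch (↥(maximalRealSubfield L)) L (IsCMField.complexConj L) N H)]
  [MeasurableSpace (cmDatum L N H).Adelic] [BorelSpace (cmDatum L N H).Adelic]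
  [∀ v, MeasurableSpace (↥(localPi L (IsCMField.complexConj L) N H' v))] [∀ v, BorelSpace (↥(localPi L (IsCMField.complexConj L) N H' v))] [∀ v, SecondCountableTopology (↥(localPi L (IsCMField.complexConj L) N H' v))]
  [BorelSpace (Πʳ v : HeightOneSpectrum (𝓞 ↥(maximalRealSubfield L)), [↥(localPi L (IsCMField.complexConj L) N H' v), localInt L (IsCMField.complexConj L) N H' v])]
  [hKc' : ∀ v, CompactSpace (localInt L (IsCMField.complexConj L) N H' v)]
  [MeasurableSpace (finAdelic (↥(maximalRealSubfield L)) L (IsCMField.complexConj L) N H')] [BorelSpace (finAdelic (↥(maximalRealSubfield L)) L (IsCMField.complexConj L) N H')] [SecondCountableTopology (finAdelic (↥(maximalRealSubfield L)) L (IsCMField.complexConj L) N H')]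
  [MeasurableSpace (arch (↥(maximalRealSubfield L)) L (IsCMField.complexConj L) N H')] [BorelSpace (arch (↥(maximalRealSubfield L)) L (IsCMField.complexConj L) N H')]
  [MeasurableSpace (cmDatum L N H').Adelic] [BorelSpace (cmDatum L N H').Adelic]

set_option maxHeartbeats 3200000 in
set_option synthInstance.maxHeartbeats 400000 in
-- HB: the concrete `cmDatum` ∕ restricted-product carrier types are expensive to unify (two torus towers in the statement; the proof is bookkeeping)
/-- **Coherence of the adelic torus measures along `adelicStableCentralizerEquiv`.**  For rational `γ ∈ U(H)(L⁺)`, `γ′ ∈ U(H′)(L⁺)` with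
`γ ↔ γ′` over `L`, `γ` regular, `det H, det H′ ≠ 0`, and torus measures `t_𝔸`, `t′_𝔸` on `Z(γ ⊗ 1)`, `Z(γ′ ⊗ 1)` in the tower expressions
(`hρ hρM htf htP htA` on both sides): if every isomorphism of the model-local tori carries `t_v` to `t′_v` (`hQ`), the integral subgroups are the
compact cores off finite sets (`hK`, `hK′`), and the measurable `P_∞` with `(P_∞)_* t_∞ = t′_∞` is the archimedean component of `e_𝔸` (`hPa`), then
`(e_𝔸)_* t_𝔸 = t′_𝔸`. [cite: Rogawski1990, §4.3 pp. 43–44; §14.5 pp. 237–238] -/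
theorem map_adelicStableCentralizerEquiv_torusMeasure_eq (hH : H.det ≠ 0) (hH' : H'.det ≠ 0)
    (hc : Corresponds (cmConjRingHom L) H H' γ γ') (hreg : IsRegularElt (γ.val : GL (Fin N) L))
    [hCP : ∀ v, IsClosed (((Subgroup.centralizer ({((finAdelicEquiv (↥(maximalRealSubfield L)) L (IsCMField.complexConj L) N H) (finPart (↥(maximalRealSubfield L)) L (IsCMField.complexConj L) N H ((cmDatum L N H).toAdelic γ))) v} : Set ↥(localPi L (IsCMField.complexConj L) N H v))) : Subgroup ↥(localPi L (IsCMField.complexConj L) N H v)) : Set ↥(localPi L (IsCMField.complexConj L) N H v))]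
    (t : ∀ v, Measure (Subgroup.centralizer ({((finAdelicEquiv (↥(maximalRealSubfield L)) L (IsCMField.complexConj L) N H) (finPart (↥(maximalRealSubfield L)) L (IsCMField.complexConj L) N H ((cmDatum L N H).toAdelic γ))) v} : Set ↥(localPi L (IsCMField.complexConj L) N H v)))) [∀ v, (t v).IsMulLeftInvariant] [∀ v, IsFiniteMeasureOnCompacts (t v)]
    [∀ v, (t v).IsOpenPosMeasure] [∀ v, SigmaFinite (t v)]
    (S : Finset (HeightOneSpectrum (𝓞 ↥(maximalRealSubfield L))))
    (ρ : Measure (cutout (fun v => localInt L (IsCMField.complexConj L) N H v) (fun v => Subgroup.centralizer ({((finAdelicEquiv (↥(maximalRealSubfield L)) L (IsCMField.complexConj L) N H) (finPart (↥(maximalRealSubfield L)) L (IsCMField.complexConj L) N H ((cmDatum L N H).toAdelic γ))) v} : Set ↥(localPi L (IsCMField.complexConj L) N H v))) : Subgroup (Πʳ v : HeightOneSpectrum (𝓞 ↥(maximalRealSubfield L)), [↥(localPi L (IsCMField.complexConj L) N H v), localInt L (IsCMField.complexConj L) N H v])))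
    (ρM : Measure (Subgroup.centralizer ({((finAdelicEquiv (↥(maximalRealSubfield L)) L (IsCMField.complexConj L) N H) (finPart (↥(maximalRealSubfield L)) L (IsCMField.complexConj L) N H ((cmDatum L N H).toAdelic γ)))} : Set (Πʳ v : HeightOneSpectrum (𝓞 ↥(maximalRealSubfield L)), [↥(localPi L (IsCMField.complexConj L) N H v), localInt L (IsCMField.complexConj L) N H v]))))
    (tf : Measure (Subgroup.centralizer ({(finPart (↥(maximalRealSubfield L)) L (IsCMField.complexConj L) N H ((cmDatum L N H).toAdelic γ))} : Set (finAdelic (↥(maximalRealSubfield L)) L (IsCMField.complexConj L) N H)))) [SFinite tf]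
    (ti : Measure (Subgroup.centralizer ({(archPart (↥(maximalRealSubfield L)) L (IsCMField.complexConj L) N H ((cmDatum L N H).toAdelic γ))} : Set (arch (↥(maximalRealSubfield L)) L (IsCMField.complexConj L) N H)))) [SFinite ti]
    (tP : Measure ((Subgroup.centralizer ({(archPart (↥(maximalRealSubfield L)) L (IsCMField.complexConj L) N H ((cmDatum L N H).toAdelic γ))} : Set (arch (↥(maximalRealSubfield L)) L (IsCMField.complexConj L) N H))).prod (Subgroup.centralizer ({(finPart (↥(maximalRealSubfield L)) L (IsCMField.complexConj L) N H ((cmDatum L N H).toAdelic γ))} : Set (finAdelic (↥(maximalRealSubfield L)) L (IsCMField.complexConj L) N H)))))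
    (tA : Measure (Subgroup.centralizer ({((cmDatum L N H).toAdelic γ)} : Set (cmDatum L N H).Adelic)))
    (e : arch (↥(maximalRealSubfield L)) L (IsCMField.complexConj L) N H × finAdelic (↥(maximalRealSubfield L)) L (IsCMField.complexConj L) N H ≃* (cmDatum L N H).Adelic)
    (hee : e = (adelicProdEquiv (↥(maximalRealSubfield L)) L (IsCMField.complexConj L) N H).symm.toMulEquiv) (he : Continuous e) (hes : Continuous e.symm)
    (hg : e ((archPart (↥(maximalRealSubfield L)) L (IsCMField.complexConj L) N H ((cmDatum L N H).toAdelic γ)), (finPart (↥(maximalRealSubfield L)) L (IsCMField.complexConj L) N H ((cmDatum L N H).toAdelic γ))) = ((cmDatum L N H).toAdelic γ))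
    [hCP' : ∀ v, IsClosed (((Subgroup.centralizer ({((finAdelicEquiv (↥(maximalRealSubfield L)) L (IsCMField.complexConj L) N H') (finPart (↥(maximalRealSubfield L)) L (IsCMField.complexConj L) N H' ((cmDatum L N H').toAdelic γ'))) v} : Set ↥(localPi L (IsCMField.complexConj L) N H' v))) : Subgroup ↥(localPi L (IsCMField.complexConj L) N H' v)) : Set ↥(localPi L (IsCMField.complexConj L) N H' v))]
    (t' : ∀ v, Measure (Subgroup.centralizer ({((finAdelicEquiv (↥(maximalRealSubfield L)) L (IsCMField.complexConj L) N H') (finPart (↥(maximalRealSubfield L)) L (IsCMField.complexConj L) N H' ((cmDatum L N H').toAdelic γ'))) v} : Set ↥(localPi L (IsCMField.complexConj L) N H' v)))) [∀ v, (t' v).IsMulLeftInvariant] [∀ v, IsFiniteMeasureOnCompacts (t' v)]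
    [∀ v, (t' v).IsOpenPosMeasure] [∀ v, SigmaFinite (t' v)]
    (S' : Finset (HeightOneSpectrum (𝓞 ↥(maximalRealSubfield L))))
    (ρ' : Measure (cutout (fun v => localInt L (IsCMField.complexConj L) N H' v) (fun v => Subgroup.centralizer ({((finAdelicEquiv (↥(maximalRealSubfield L)) L (IsCMField.complexConj L) N H') (finPart (↥(maximalRealSubfield L)) L (IsCMField.complexConj L) N H' ((cmDatum L N H').toAdelic γ'))) v} : Set ↥(localPi L (IsCMField.complexConj L) N H' v))) : Subgroup (Πʳ v : HeightOneSpectrum (𝓞 ↥(maximalRealSubfield L)), [↥(localPi L (IsCMField.complexConj L) N H' v), localInt L (IsCMField.complexConj L) N H' v])))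
    (ρM' : Measure (Subgroup.centralizer ({((finAdelicEquiv (↥(maximalRealSubfield L)) L (IsCMField.complexConj L) N H') (finPart (↥(maximalRealSubfield L)) L (IsCMField.complexConj L) N H' ((cmDatum L N H').toAdelic γ')))} : Set (Πʳ v : HeightOneSpectrum (𝓞 ↥(maximalRealSubfield L)), [↥(localPi L (IsCMField.complexConj L) N H' v), localInt L (IsCMField.complexConj L) N H' v]))))
    (tf' : Measure (Subgroup.centralizer ({(finPart (↥(maximalRealSubfield L)) L (IsCMField.complexConj L) N H' ((cmDatum L N H').toAdelic γ'))} : Set (finAdelic (↥(maximalRealSubfield L)) L (IsCMField.complexConj L) N H')))) [SFinite tf']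
    (ti' : Measure (Subgroup.centralizer ({(archPart (↥(maximalRealSubfield L)) L (IsCMField.complexConj L) N H' ((cmDatum L N H').toAdelic γ'))} : Set (arch (↥(maximalRealSubfield L)) L (IsCMField.complexConj L) N H')))) [SFinite ti']
    (tP' : Measure ((Subgroup.centralizer ({(archPart (↥(maximalRealSubfield L)) L (IsCMField.complexConj L) N H' ((cmDatum L N H').toAdelic γ'))} : Set (arch (↥(maximalRealSubfield L)) L (IsCMField.complexConj L) N H'))).prod (Subgroup.centralizer ({(finPart (↥(maximalRealSubfield L)) L (IsCMField.complexConj L) N H' ((cmDatum L N H').toAdelic γ'))} : Set (finAdelic (↥(maximalRealSubfield L)) L (IsCMField.complexConj L) N H')))))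
    (tA' : Measure (Subgroup.centralizer ({((cmDatum L N H').toAdelic γ')} : Set (cmDatum L N H').Adelic)))
    (e' : arch (↥(maximalRealSubfield L)) L (IsCMField.complexConj L) N H' × finAdelic (↥(maximalRealSubfield L)) L (IsCMField.complexConj L) N H' ≃* (cmDatum L N H').Adelic)
    (hee' : e' = (adelicProdEquiv (↥(maximalRealSubfield L)) L (IsCMField.complexConj L) N H').symm.toMulEquiv) (he' : Continuous e') (hes' : Continuous e'.symm)
    (hg' : e' ((archPart (↥(maximalRealSubfield L)) L (IsCMField.complexConj L) N H' ((cmDatum L N H').toAdelic γ')), (finPart (↥(maximalRealSubfield L)) L (IsCMField.complexConj L) N H' ((cmDatum L N H').toAdelic γ'))) = ((cmDatum L N H').toAdelic γ'))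
    (ht1 : ∀ v, v ∉ S → t v ((inH (fun v => localInt L (IsCMField.complexConj L) N H v) (fun v => Subgroup.centralizer ({((finAdelicEquiv (↥(maximalRealSubfield L)) L (IsCMField.complexConj L) N H) (finPart (↥(maximalRealSubfield L)) L (IsCMField.complexConj L) N H ((cmDatum L N H).toAdelic γ))) v} : Set ↥(localPi L (IsCMField.complexConj L) N H v))) v : Subgroup (Subgroup.centralizer ({((finAdelicEquiv (↥(maximalRealSubfield L)) L (IsCMField.complexConj L) N H) (finPart (↥(maximalRealSubfield L)) L (IsCMField.complexConj L) N H ((cmDatum L N H).toAdelic γ))) v} : Set ↥(localPi L (IsCMField.complexConj L) N H v)))) : Set (Subgroup.centralizer ({((finAdelicEquiv (↥(maximalRealSubfield L)) L (IsCMField.complexConj L) N H) (finPart (↥(maximalRealSubfield L)) L (IsCMField.complexConj L) N H ((cmDatum L N H).toAdelic γ))) v} : Set ↥(localPi L (IsCMField.complexConj L) N H v)))) = 1)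
    (hρ : ρ = Measure.map (cutoutEquiv (fun v => localInt L (IsCMField.complexConj L) N H v) (fun v => Subgroup.centralizer ({((finAdelicEquiv (↥(maximalRealSubfield L)) L (IsCMField.complexConj L) N H) (finPart (↥(maximalRealSubfield L)) L (IsCMField.complexConj L) N H ((cmDatum L N H).toAdelic γ))) v} : Set ↥(localPi L (IsCMField.complexConj L) N H v))))
      (rpMeasure (fun v => ((inH (fun v => localInt L (IsCMField.complexConj L) N H v) (fun v => Subgroup.centralizer ({((finAdelicEquiv (↥(maximalRealSubfield L)) L (IsCMField.complexConj L) N H) (finPart (↥(maximalRealSubfield L)) L (IsCMField.complexConj L) N H ((cmDatum L N H).toAdelic γ))) v} : Set ↥(localPi L (IsCMField.complexConj L) N H v))) v : Subgroup (Subgroup.centralizer ({((finAdelicEquiv (↥(maximalRealSubfield L)) L (IsCMField.complexConj L) N H) (finPart (↥(maximalRealSubfield L)) L (IsCMField.complexConj L) N H ((cmDatum L N H).toAdelic γ))) v} : Set ↥(localPi L (IsCMField.complexConj L) N H v)))) : Set (Subgroup.centralizer ({((finAdelicEquiv (↥(maximalRealSubfield L)) L (IsCMField.complexConj L) N H) (finPart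 (↥(maximalRealSubfield L)) L (IsCMField.complexConj L) N H ((cmDatum L N H).toAdelic γ))) v} : Set ↥(localPi L (IsCMField.complexConj L) N H v))))) t S))
    (hρM : ρM = Measure.map (subgroupCongrHomeomorph (MulEquiv.refl (Πʳ v : HeightOneSpectrum (𝓞 ↥(maximalRealSubfield L)), [↥(localPi L (IsCMField.complexConj L) N H v), localInt L (IsCMField.complexConj L) N H v]))
      (cutout (fun v => localInt L (IsCMField.complexConj L) N H v) (fun v => Subgroup.centralizer ({((finAdelicEquiv (↥(maximalRealSubfield L)) L (IsCMField.complexConj L) N H) (finPart (↥(maximalRealSubfield L)) L (IsCMField.complexConj L) N H ((cmDatum L N H).toAdelic γ))) v} : Set ↥(localPi L (IsCMField.complexConj L) N H v)))) (Subgroup.centralizer ({((finAdelicEquiv (↥(maximalRealSubfield L)) L (IsCMField.complexConj L) N H) (finPart (↥(maximalRealSubfield L)) L (IsCMField.complexConj L) N H ((cmDatum L N H).toAdelic γ)))} : Set (Πʳ v : HeightOneSpectrum (𝓞 ↥(maximalRealSubfield L)), [↥(localPi L (IsCMField.complexConj L) N H v), localInt L (IsCMField.complexConj L) N H v])))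
      (forall_refl_mem_iff (fun v => localInt L (IsCMField.complexConj L) N H v) (fun v => Subgroup.centralizer ({((finAdelicEquiv (↥(maximalRealSubfield L)) L (IsCMField.complexConj L) N H) (finPart (↥(maximalRealSubfield L)) L (IsCMField.complexConj L) N H ((cmDatum L N H).toAdelic γ))) v} : Set ↥(localPi L (IsCMField.complexConj L) N H v))) _ (mem_centralizer_singleton_iff_forall_mem (fun v => localInt L (IsCMField.complexConj L) N H v) ((finAdelicEquiv (↥(maximalRealSubfield L)) L (IsCMField.complexConj L) N H) (finPart (↥(maximalRealSubfield L)) L (IsCMField.complexConj L) N H ((cmDatum L N H).toAdelic γ)))))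
      continuous_id continuous_id) ρ)
    (htf : tf = Measure.map (subgroupCongrHomeomorph (finAdelicEquiv (↥(maximalRealSubfield L)) L (IsCMField.complexConj L) N H).symm.toMulEquiv (Subgroup.centralizer ({((finAdelicEquiv (↥(maximalRealSubfield L)) L (IsCMField.complexConj L) N H) (finPart (↥(maximalRealSubfield L)) L (IsCMField.complexConj L) N H ((cmDatum L N H).toAdelic γ)))} : Set (Πʳ v : HeightOneSpectrum (𝓞 ↥(maximalRealSubfield L)), [↥(localPi L (IsCMField.complexConj L) N H v), localInt L (IsCMField.complexConj L) N H v]))) (Subgroup.centralizer ({(finPart (↥(maximalRealSubfield L)) L (IsCMField.complexConj L) N H ((cmDatum L N H).toAdelic γ))} : Set (finAdelic (↥(maximalRealSubfield L)) L (IsCMField.complexConj L) N H)))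
      (forall_apply_mem_centralizer_singleton_iff_of_eq (finAdelicEquiv (↥(maximalRealSubfield L)) L (IsCMField.complexConj L) N H).symm.toMulEquiv ((finAdelicEquiv (↥(maximalRealSubfield L)) L (IsCMField.complexConj L) N H).symm_apply_apply (finPart (↥(maximalRealSubfield L)) L (IsCMField.complexConj L) N H ((cmDatum L N H).toAdelic γ))))
      (finAdelicEquiv (↥(maximalRealSubfield L)) L (IsCMField.complexConj L) N H).symm.continuous (finAdelicEquiv (↥(maximalRealSubfield L)) L (IsCMField.complexConj L) N H).continuous) ρM)
    (htP : Measure.map (Subgroup.prodEquiv (Subgroup.centralizer ({(archPart (↥(maximalRealSubfield L)) L (IsCMField.complexConj L) N H ((cmDatum L N H).toAdelic γ))} : Set (arch (↥(maximalRealSubfield L)) L (IsCMField.complexConj L) N H))) (Subgroup.centralizer ({(finPart (↥(maximalRealSubfield L)) L (IsCMField.complexConj L) N H ((cmDatum L N H).toAdelic γ))} : Set (finAdelic (↥(maximalRealSubfield L)) L (IsCMField.complexConj L) N H)))) tP = ti.prod tf)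
    (htA : tA = Measure.map (subgroupCongrHomeomorph e ((Subgroup.centralizer ({(archPart (↥(maximalRealSubfield L)) L (IsCMField.complexConj L) N H ((cmDatum L N H).toAdelic γ))} : Set (arch (↥(maximalRealSubfield L)) L (IsCMField.complexConj L) N H))).prod (Subgroup.centralizer ({(finPart (↥(maximalRealSubfield L)) L (IsCMField.complexConj L) N H ((cmDatum L N H).toAdelic γ))} : Set (finAdelic (↥(maximalRealSubfield L)) L (IsCMField.complexConj L) N H)))) (Subgroup.centralizer ({((cmDatum L N H).toAdelic γ)} : Set (cmDatum L N H).Adelic)) (forall_apply_mem_centralizer_iff e hg) he hes) tP)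
    (ht1' : ∀ v, v ∉ S' → t' v ((inH (fun v => localInt L (IsCMField.complexConj L) N H' v) (fun v => Subgroup.centralizer ({((finAdelicEquiv (↥(maximalRealSubfield L)) L (IsCMField.complexConj L) N H') (finPart (↥(maximalRealSubfield L)) L (IsCMField.complexConj L) N H' ((cmDatum L N H').toAdelic γ'))) v} : Set ↥(localPi L (IsCMField.complexConj L) N H' v))) v : Subgroup (Subgroup.centralizer ({((finAdelicEquiv (↥(maximalRealSubfield L)) L (IsCMField.complexConj L) N H') (finPart (↥(maximalRealSubfield L)) L (IsCMField.complexConj L) N H' ((cmDatum L N H').toAdelic γ'))) v} : Set ↥(localPi L (IsCMField.complexConj L) N H' v)))) : Set (Subgroup.centralizer ({((finAdelicEquiv (↥(maximalRealSubfield L)) L (IsCMField.complexConj L) N H') (finPart (↥(maximalRealSubfield L)) L (IsCMField.complexConj L) N H' ((cmDatum L N H').toAdelic γ'))) v} : Set ↥(localPi L (IsCMField.complexConj L) N H' v)))) = 1)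
    (hρ' : ρ' = Measure.map (cutoutEquiv (fun v => localInt L (IsCMField.complexConj L) N H' v) (fun v => Subgroup.centralizer ({((finAdelicEquiv (↥(maximalRealSubfield L)) L (IsCMField.complexConj L) N H') (finPart (↥(maximalRealSubfield L)) L (IsCMField.complexConj L) N H' ((cmDatum L N H').toAdelic γ'))) v} : Set ↥(localPi L (IsCMField.complexConj L) N H' v))))
      (rpMeasure (fun v => ((inH (fun v => localInt L (IsCMField.complexConj L) N H' v) (fun v => Subgroup.centralizer ({((finAdelicEquiv (↥(maximalRealSubfield L)) L (IsCMField.complexConj L) N H') (finPart (↥(maximalRealSubfield L)) L (IsCMField.complexConj L) N H' ((cmDatum L N H').toAdelic γ'))) v} : Set ↥(localPi L (IsCMField.complexConj L) N H' v))) v : Subgroup (Subgroup.centralizer ({((finAdelicEquiv (↥(maximalRealSubfield L)) L (IsCMField.complexConj L) N H') (finPart (↥(maximalRealSubfield L)) L (IsCMField.complexConj L) N H' ((cmDatum L N H').toAdelic γ'))) v} : Set ↥(localPi L (IsCMField.complexConj L) N H' v)))) : Set (Subgroup.centralizer ({((finAdelicEquiv (↥(maximalRealSubfield L)) L (IsCMField.complexConj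 L) N H') (finPart (↥(maximalRealSubfield L)) L (IsCMField.complexConj L) N H' ((cmDatum L N H').toAdelic γ'))) v} : Set ↥(localPi L (IsCMField.complexConj L) N H' v))))) t' S'))
    (hρM' : ρM' = Measure.map (subgroupCongrHomeomorph (MulEquiv.refl (Πʳ v : HeightOneSpectrum (𝓞 ↥(maximalRealSubfield L)), [↥(localPi L (IsCMField.complexConj L) N H' v), localInt L (IsCMField.complexConj L) N H' v]))
      (cutout (fun v => localInt L (IsCMField.complexConj L) N H' v) (fun v => Subgroup.centralizer ({((finAdelicEquiv (↥(maximalRealSubfield L)) L (IsCMField.complexConj L) N H') (finPart (↥(maximalRealSubfield L)) L (IsCMField.complexConj L) N H' ((cmDatum L N H').toAdelic γ'))) v} : Set ↥(localPi L (IsCMField.complexConj L) N H' v)))) (Subgroup.centralizer ({((finAdelicEquiv (↥(maximalRealSubfield L)) L (IsCMField.complexConj L) N H') (finPart (↥(maximalRealSubfield L)) L (IsCMField.complexConj L) N H' ((cmDatum L N H').toAdelic γ')))} : Set (Πʳ v : HeightOneSpectrum (𝓞 ↥(maximalRealSubfield L)), [↥(localPi L (IsCMField.complexConj L) N H' v),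 localInt L (IsCMField.complexConj L) N H' v])))
      (forall_refl_mem_iff (fun v => localInt L (IsCMField.complexConj L) N H' v) (fun v => Subgroup.centralizer ({((finAdelicEquiv (↥(maximalRealSubfield L)) L (IsCMField.complexConj L) N H') (finPart (↥(maximalRealSubfield L)) L (IsCMField.complexConj L) N H' ((cmDatum L N H').toAdelic γ'))) v} : Set ↥(localPi L (IsCMField.complexConj L) N H' v))) _ (mem_centralizer_singleton_iff_forall_mem (fun v => localInt L (IsCMField.complexConj L) N H' v) ((finAdelicEquiv (↥(maximalRealSubfield L)) L (IsCMField.complexConj L) N H') (finPart (↥(maximalRealSubfield L)) L (IsCMField.complexConj L) N H' ((cmDatum L N H').toAdelic γ')))))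
      continuous_id continuous_id) ρ')
    (htf' : tf' = Measure.map (subgroupCongrHomeomorph (finAdelicEquiv (↥(maximalRealSubfield L)) L (IsCMField.complexConj L) N H').symm.toMulEquiv (Subgroup.centralizer ({((finAdelicEquiv (↥(maximalRealSubfield L)) L (IsCMField.complexConj L) N H') (finPart (↥(maximalRealSubfield L)) L (IsCMField.complexConj L) N H' ((cmDatum L N H').toAdelic γ')))} : Set (Πʳ v : HeightOneSpectrum (𝓞 ↥(maximalRealSubfield L)), [↥(localPi L (IsCMField.complexConj L) N H' v), localInt L (IsCMField.complexConj L) N H' v]))) (Subgroup.centralizer ({(finPart (↥(maximalRealSubfield L)) L (IsCMField.complexConj L) N H' ((cmDatum L N H').toAdelic γ'))} : Set (finAdelic (↥(maximalRealSubfield L)) L (IsCMField.complexConj L) N H')))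
      (forall_apply_mem_centralizer_singleton_iff_of_eq (finAdelicEquiv (↥(maximalRealSubfield L)) L (IsCMField.complexConj L) N H').symm.toMulEquiv ((finAdelicEquiv (↥(maximalRealSubfield L)) L (IsCMField.complexConj L) N H').symm_apply_apply (finPart (↥(maximalRealSubfield L)) L (IsCMField.complexConj L) N H' ((cmDatum L N H').toAdelic γ'))))
      (finAdelicEquiv (↥(maximalRealSubfield L)) L (IsCMField.complexConj L) N H').symm.continuous (finAdelicEquiv (↥(maximalRealSubfield L)) L (IsCMField.complexConj L) N H').continuous) ρM')
    (htP' : Measure.map (Subgroup.prodEquiv (Subgroup.centralizer ({(archPart (↥(maximalRealSubfield L)) L (IsCMField.complexConj L) N H' ((cmDatum L N H').toAdelic γ'))} : Set (arch (↥(maximalRealSubfield L)) L (IsCMField.complexConj L) N H'))) (Subgroup.centralizer ({(finPart (↥(maximalRealSubfield L)) L (IsCMField.complexConj L) N H' ((cmDatum L N H').toAdelic γ'))} : Set (finAdelic (↥(maximalRealSubfield L)) L (IsCMField.complexConj L) N H')))) tP' = ti'.prod tf')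
    (htA' : tA' = Measure.map (subgroupCongrHomeomorph e' ((Subgroup.centralizer ({(archPart (↥(maximalRealSubfield L)) L (IsCMField.complexConj L) N H' ((cmDatum L N H').toAdelic γ'))} : Set (arch (↥(maximalRealSubfield L)) L (IsCMField.complexConj L) N H'))).prod (Subgroup.centralizer ({(finPart (↥(maximalRealSubfield L)) L (IsCMField.complexConj L) N H' ((cmDatum L N H').toAdelic γ'))} : Set (finAdelic (↥(maximalRealSubfield L)) L (IsCMField.complexConj L) N H')))) (Subgroup.centralizer ({((cmDatum L N H').toAdelic γ')} : Set (cmDatum L N H').Adelic)) (forall_apply_mem_centralizer_iff e' hg') he' hes') tP')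
    -- coherence inputs
    (hQ : ∀ v (Q : (Subgroup.centralizer ({((finAdelicEquiv (↥(maximalRealSubfield L)) L (IsCMField.complexConj L) N H) (finPart (↥(maximalRealSubfield L)) L (IsCMField.complexConj L) N H ((cmDatum L N H).toAdelic γ))) v} : Set ↥(localPi L (IsCMField.complexConj L) N H v))) ≃ₜ* (Subgroup.centralizer ({((finAdelicEquiv (↥(maximalRealSubfield L)) L (IsCMField.complexConj L) N H') (finPart (↥(maximalRealSubfield L)) L (IsCMField.complexConj L) N H' ((cmDatum L N H').toAdelic γ'))) v} : Set ↥(localPi L (IsCMField.complexConj L) N H' v)))), Measure.map Q (t v) = t' v)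
    (hK : ∀ᶠ v in cofinite, ((inH (fun v => localInt L (IsCMField.complexConj L) N H v) (fun v => Subgroup.centralizer ({((finAdelicEquiv (↥(maximalRealSubfield L)) L (IsCMField.complexConj L) N H) (finPart (↥(maximalRealSubfield L)) L (IsCMField.complexConj L) N H ((cmDatum L N H).toAdelic γ))) v} : Set ↥(localPi L (IsCMField.complexConj L) N H v))) v : Subgroup (Subgroup.centralizer ({((finAdelicEquiv (↥(maximalRealSubfield L)) L (IsCMField.complexConj L) N H) (finPart (↥(maximalRealSubfield L)) L (IsCMField.complexConj L) N H ((cmDatum L N H).toAdelic γ))) v} : Set ↥(localPi L (IsCMField.complexConj L) N H v)))) : Set (Subgroup.centralizer ({((finAdelicEquiv (↥(maximalRealSubfield L)) L (IsCMField.complexConj L) N H) (finPart (↥(maximalRealSubfield L)) L (IsCMField.complexConj L) N H ((cmDatum L N H).toAdelic γ))) v} : Set ↥(localPi L (IsCMField.complexConj L) N H v)))) =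
      compactCore (Subgroup.centralizer ({((finAdelicEquiv (↥(maximalRealSubfield L)) L (IsCMField.complexConj L) N H) (finPart (↥(maximalRealSubfield L)) L (IsCMField.complexConj L) N H ((cmDatum L N H).toAdelic γ))) v} : Set ↥(localPi L (IsCMField.complexConj L) N H v))))
    (hK' : ∀ᶠ v in cofinite, ((inH (fun v => localInt L (IsCMField.complexConj L) N H' v) (fun v => Subgroup.centralizer ({((finAdelicEquiv (↥(maximalRealSubfield L)) L (IsCMField.complexConj L) N H') (finPart (↥(maximalRealSubfield L)) L (IsCMField.complexConj L) N H' ((cmDatum L N H').toAdelic γ'))) v} : Set ↥(localPi L (IsCMField.complexConj L) N H' v))) v : Subgroup (Subgroup.centralizer ({((finAdelicEquiv (↥(maximalRealSubfield L)) L (IsCMField.complexConj L) N H') (finPart (↥(maximalRealSubfield L)) L (IsCMField.complexConj L) N H' ((cmDatum L N H').toAdelic γ'))) v} : Set ↥(localPi L (IsCMField.complexConj L) N H' v)))) : Set (Subgroup.centralizer ({((finAdelicEquiv (↥(maximalRealSubfield L)) L (IsCMField.complexConj L) N H') (finPart (↥(maximalRealSubfield L)) L (IsCMField.complexConj L) N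 H' ((cmDatum L N H').toAdelic γ'))) v} : Set ↥(localPi L (IsCMField.complexConj L) N H' v)))) =
      compactCore (Subgroup.centralizer ({((finAdelicEquiv (↥(maximalRealSubfield L)) L (IsCMField.complexConj L) N H') (finPart (↥(maximalRealSubfield L)) L (IsCMField.complexConj L) N H' ((cmDatum L N H').toAdelic γ'))) v} : Set ↥(localPi L (IsCMField.complexConj L) N H' v))))
    (Pa : (Subgroup.centralizer ({(archPart (↥(maximalRealSubfield L)) L (IsCMField.complexConj L) N H ((cmDatum L N H).toAdelic γ))} : Set (arch (↥(maximalRealSubfield L)) L (IsCMField.complexConj L) N H))) → (Subgroup.centralizer ({(archPart (↥(maximalRealSubfield L)) L (IsCMField.complexConj L) N H' ((cmDatum L N H').toAdelic γ'))} : Set (arch (↥(maximalRealSubfield L)) L (IsCMField.complexConj L) N H')))) (hPam : Measurable Pa) (ha : Measure.map Pa ti = ti')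
    (hPa : ∀ (z : (Subgroup.centralizer ({((cmDatum L N H).toAdelic γ)} : Set (cmDatum L N H).Adelic))) (hz : archPart (↥(maximalRealSubfield L)) L (IsCMField.complexConj L) N H (z : (cmDatum L N H).Adelic) ∈ (Subgroup.centralizer ({(archPart (↥(maximalRealSubfield L)) L (IsCMField.complexConj L) N H ((cmDatum L N H).toAdelic γ))} : Set (arch (↥(maximalRealSubfield L)) L (IsCMField.complexConj L) N H)))),
      archPart (↥(maximalRealSubfield L)) L (IsCMField.complexConj L) N H' (((adelicStableCentralizerEquiv L hH hH' hc hreg) z : (Subgroup.centralizer ({((cmDatum L N H').toAdelic γ')} : Set (cmDatum L N H').Adelic))) : (cmDatum L N H').Adelic) = ((Pa ⟨_, hz⟩ : (Subgroup.centralizer ({(archPart (↥(maximalRealSubfield L)) L (IsCMField.complexConj L) N H' ((cmDatum L N H').toAdelic γ'))} : Set (arch (↥(maximalRealSubfield L)) L (IsCMField.complexConj L) N H')))) : arch (↥(maximalRealSubfield L)) L (IsCMField.complexConj L) N H')) :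
    Measure.map (adelicStableCentralizerEquiv L hH hH' hc hreg) tA = tA' := by
  classical
  haveI : Countable (HeightOneSpectrum (𝓞 ↥(maximalRealSubfield L))) := countable_heightOneSpectrum ↥(maximalRealSubfield L)
  -- (0) regularity of `γ_v` at every finite place
  have hregv : ∀ w, IsRegularElt ((((cmDatum L N H).toLocal w ((cmDatum L N H).toAdelic γ))).val : GL (Fin N) (LocalRing L w)) := fun w =>
    isRegularElt_toLocal_toAdelic L H γ hreg w
  -- (1) the datum-side local points are the model points read along `localPiEquiv`
  have hγv : ∀ w, (cmDatum L N H).toLocal w ((cmDatum L N H).toAdelic γ) = (localPiEquiv L (IsCMField.complexConj L) N H w) (((finAdelicEquiv (↥(maximalRealSubfield L)) L (IsCMField.complexConj L) N H) (finPart (↥(maximalRealSubfield L)) L (IsCMField.complexConj L) N H ((cmDatum L N H).toAdelic γ))) w) := fun w =>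
    cmDatum_toLocal_eq_localPiEquiv L H w ((cmDatum L N H).toAdelic γ)
  have hγv' : ∀ w, (cmDatum L N H').toLocal w ((cmDatum L N H').toAdelic γ') = (localPiEquiv L (IsCMField.complexConj L) N H' w) (((finAdelicEquiv (↥(maximalRealSubfield L)) L (IsCMField.complexConj L) N H') (finPart (↥(maximalRealSubfield L)) L (IsCMField.complexConj L) N H' ((cmDatum L N H').toAdelic γ'))) w) := fun w =>
    cmDatum_toLocal_eq_localPiEquiv L H' w ((cmDatum L N H').toAdelic γ')
  -- (2) model ≃ datum on the local tori, both sides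
  have hQ1 : ∀ w, ∃ Q : (Subgroup.centralizer ({((finAdelicEquiv (↥(maximalRealSubfield L)) L (IsCMField.complexConj L) N H) (finPart (↥(maximalRealSubfield L)) L (IsCMField.complexConj L) N H ((cmDatum L N H).toAdelic γ))) w} : Set ↥(localPi L (IsCMField.complexConj L) N H w))) ≃ₜ* (Subgroup.centralizer ({(cmDatum L N H).toLocal w ((cmDatum L N H).toAdelic γ)} : Set ((cmDatum L N H).Local w))), ∀ s, ((Q s : (Subgroup.centralizer ({(cmDatum L N H).toLocal w ((cmDatum L N H).toAdelic γ)} : Set ((cmDatum L N H).Local w)))) : (cmDatum L N H).Local w) =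
      (localPiEquiv L (IsCMField.complexConj L) N H w) (s : ↥(localPi L (IsCMField.complexConj L) N H w)) := fun w =>
    exists_continuousMulEquiv_subgroup_apply_eq (localPiEquiv L (IsCMField.complexConj L) N H w) _ _
      (forall_apply_mem_centralizer_singleton_iff_of_eq (localPiEquiv L (IsCMField.complexConj L) N H w).toMulEquiv (hγv w).symm)
  choose Q₁ hQ₁ using hQ1
  have hQ3 : ∀ w, ∃ Q : (Subgroup.centralizer ({(cmDatum L N H').toLocal w ((cmDatum L N H').toAdelic γ')} : Set ((cmDatum L N H').Local w))) ≃ₜ* (Subgroup.centralizer ({((finAdelicEquiv (↥(maximalRealSubfield L)) L (IsCMField.complexConj L) N H') (finPart (↥(maximalRealSubfield L)) L (IsCMField.complexConj L) N H' ((cmDatum L N H').toAdelic γ'))) w} : Set ↥(localPi L (IsCMField.complexConj L) N H' w))), ∀ s, ((Q s : (Subgroup.centralizer ({((finAdelicEquiv (↥(maximalRealSubfield L)) L (IsCMField.complexConj L) N H') (finPart (↥(maximalRealSubfield L)) L (IsCMField.complexConj L) N H' ((cmDatum L N H').toAdelic γ'))) w} : Set ↥(localPi L (IsCMField.complexConj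 L) N H' w)))) : ↥(localPi L (IsCMField.complexConj L) N H' w)) =
      (localPiEquiv L (IsCMField.complexConj L) N H' w).symm (s : (cmDatum L N H').Local w) := fun w =>
    exists_continuousMulEquiv_subgroup_apply_eq (localPiEquiv L (IsCMField.complexConj L) N H' w).symm _ _
      (forall_apply_mem_centralizer_singleton_iff_of_eq (localPiEquiv L (IsCMField.complexConj L) N H' w).symm.toMulEquiv
        (by rw [hγv' w]; exact (localPiEquiv L (IsCMField.complexConj L) N H' w).symm_apply_apply _))
  choose Q₃ hQ₃ using hQ3
  -- (3) the model-local isomorphisms `P_v = Q₃ ∘ e_v ∘ Q₁` and their reading on the datum side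
  have hP : ∀ w (s : (Subgroup.centralizer ({((finAdelicEquiv (↥(maximalRealSubfield L)) L (IsCMField.complexConj L) N H) (finPart (↥(maximalRealSubfield L)) L (IsCMField.complexConj L) N H ((cmDatum L N H).toAdelic γ))) w} : Set ↥(localPi L (IsCMField.complexConj L) N H w)))),
      (localPiEquiv L (IsCMField.complexConj L) N H' w) ((((((Q₁ w).trans (localStableCentralizerEquiv L w hH hH' (corresponds_toLocal_toAdelic hc w) (hregv w))).trans (Q₃ w)) s : (Subgroup.centralizer ({((finAdelicEquiv (↥(maximalRealSubfield L)) L (IsCMField.complexConj L) N H') (finPart (↥(maximalRealSubfield L)) L (IsCMField.complexConj L) N H' ((cmDatum L N H').toAdelic γ'))) w} : Set ↥(localPi L (IsCMField.complexConj L) N H' w)))) : ↥(localPi L (IsCMField.complexConj L) N H' w))) =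
        (((localStableCentralizerEquiv L w hH hH' (corresponds_toLocal_toAdelic hc w) (hregv w)) (Q₁ w s) : (Subgroup.centralizer ({(cmDatum L N H').toLocal w ((cmDatum L N H').toAdelic γ')} : Set ((cmDatum L N H').Local w)))) : (cmDatum L N H').Local w) := by
    intro w s
    change (localPiEquiv L (IsCMField.complexConj L) N H' w) (((Q₃ w ((localStableCentralizerEquiv L w hH hH' (corresponds_toLocal_toAdelic hc w) (hregv w)) (Q₁ w s)) : (Subgroup.centralizer ({((finAdelicEquiv (↥(maximalRealSubfield L)) L (IsCMField.complexConj L) N H') (finPart (↥(maximalRealSubfield L)) L (IsCMField.complexConj L) N H' ((cmDatum L N H').toAdelic γ'))) w} : Set ↥(localPi L (IsCMField.complexConj L) N H' w)))) : ↥(localPi L (IsCMField.complexConj L) N H' w))) = _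
    rw [hQ₃, ContinuousMulEquiv.apply_symm_apply]
  -- (4) the integral subgroups: both are the compact cores off a finite set, and isomorphisms respect compact cores
  have hPK : ∀ᶠ w in cofinite, ∀ s : (Subgroup.centralizer ({((finAdelicEquiv (↥(maximalRealSubfield L)) L (IsCMField.complexConj L) N H) (finPart (↥(maximalRealSubfield L)) L (IsCMField.complexConj L) N H ((cmDatum L N H).toAdelic γ))) w} : Set ↥(localPi L (IsCMField.complexConj L) N H w))),
      (((((Q₁ w).trans (localStableCentralizerEquiv L w hH hH' (corresponds_toLocal_toAdelic hc w) (hregv w))).trans (Q₃ w)) s : (Subgroup.centralizer ({((finAdelicEquiv (↥(maximalRealSubfield L)) L (IsCMField.complexConj L) N H') (finPart (↥(maximalRealSubfield L)) L (IsCMField.complexConj L) N H' ((cmDatum L N H').toAdelic γ'))) w} : Set ↥(localPi L (IsCMField.complexConj L) N H' w)))) : ↥(localPi L (IsCMField.complexConj L) N H' w)) ∈ localInt L (IsCMField.complexConj L) N H' w ↔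
        (s : ↥(localPi L (IsCMField.complexConj L) N H w)) ∈ localInt L (IsCMField.complexConj L) N H w := by
    filter_upwards [hK, hK'] with w hw hw' s
    have e1 : ∀ x : (Subgroup.centralizer ({((finAdelicEquiv (↥(maximalRealSubfield L)) L (IsCMField.complexConj L) N H) (finPart (↥(maximalRealSubfield L)) L (IsCMField.complexConj L) N H ((cmDatum L N H).toAdelic γ))) w} : Set ↥(localPi L (IsCMField.complexConj L) N H w))), (x : ↥(localPi L (IsCMField.complexConj L) N H w)) ∈ localInt L (IsCMField.complexConj L) N H w ↔ x ∈ compactCore (Subgroup.centralizer ({((finAdelicEquiv (↥(maximalRealSubfield L)) L (IsCMField.complexConj L) N H) (finPart (↥(maximalRealSubfield L)) L (IsCMField.complexConj L) N H ((cmDatum L N H).toAdelic γ))) w} : Set ↥(localPi L (IsCMField.complexConj L) N H w))) := fun x => by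
      rw [← hw]; exact Subgroup.mem_subgroupOf.symm
    have e2 : ∀ y : (Subgroup.centralizer ({((finAdelicEquiv (↥(maximalRealSubfield L)) L (IsCMField.complexConj L) N H') (finPart (↥(maximalRealSubfield L)) L (IsCMField.complexConj L) N H' ((cmDatum L N H').toAdelic γ'))) w} : Set ↥(localPi L (IsCMField.complexConj L) N H' w))), (y : ↥(localPi L (IsCMField.complexConj L) N H' w)) ∈ localInt L (IsCMField.complexConj L) N H' w ↔ y ∈ compactCore (Subgroup.centralizer ({((finAdelicEquiv (↥(maximalRealSubfield L)) L (IsCMField.complexConj L) N H') (finPart (↥(maximalRealSubfield L)) L (IsCMField.complexConj L) N H' ((cmDatum L N H').toAdelic γ'))) w} : Set ↥(localPi L (IsCMField.complexConj L) N H' w))) := fun y => by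
      rw [← hw']; exact Subgroup.mem_subgroupOf.symm
    exact (e2 _).trans ((apply_mem_compactCore_iff _ s).trans (e1 s).symm)
  -- (5) `e = adelicProdEquiv⁻¹`: components
  have hes1 : ∀ x : (cmDatum L N H).Adelic, (e.symm x).1 = archPart (↥(maximalRealSubfield L)) L (IsCMField.complexConj L) N H x := fun x => by subst hee; rfl
  have hes2 : ∀ x : (cmDatum L N H).Adelic, (e.symm x).2 = finPart (↥(maximalRealSubfield L)) L (IsCMField.complexConj L) N H x := fun x => by subst hee; rfl
  have hes1' : ∀ x : (cmDatum L N H').Adelic, (e'.symm x).1 = archPart (↥(maximalRealSubfield L)) L (IsCMField.complexConj L) N H' x := fun x => by subst hee'; rfl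
  have hes2' : ∀ x : (cmDatum L N H').Adelic, (e'.symm x).2 = finPart (↥(maximalRealSubfield L)) L (IsCMField.complexConj L) N H' x := fun x => by subst hee'; rfl
  -- (6) assemble
  refine map_torusMeasure_eq_of_componentwise (fun w => localInt L (IsCMField.complexConj L) N H w) (finAdelicEquiv (↥(maximalRealSubfield L)) L (IsCMField.complexConj L) N H) (finPart (↥(maximalRealSubfield L)) L (IsCMField.complexConj L) N H ((cmDatum L N H).toAdelic γ)) t S ρ ρM tf e he hes hg ti tP tA
    (fun w => localInt L (IsCMField.complexConj L) N H' w) (finAdelicEquiv (↥(maximalRealSubfield L)) L (IsCMField.complexConj L) N H') (finPart (↥(maximalRealSubfield L)) L (IsCMField.complexConj L) N H' ((cmDatum L N H').toAdelic γ')) t' S' ρ' ρM' tf' e' he' hes' hg' ti' tP' tA'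
    ht1 hρ hρM htf ht1' hρ' hρM' htf' htP htA htP' htA'
    (fun w => ((Q₁ w).trans (localStableCentralizerEquiv L w hH hH' (corresponds_toLocal_toAdelic hc w) (hregv w))).trans (Q₃ w)) hPK (fun w => hQ w _) Pa hPam ha (adelicStableCentralizerEquiv L hH hH' hc hreg) (fun x hx => ?_) (fun x w hx => ?_)
  · -- archimedean component
    have hx' := hx
    rw [hes1 x] at hx'
    rw [hes1', hPa x hx']
    congr 2
    exact Subtype.ext (hes1 x).symm
  · -- finite components, read on the datum side along `localPiEquiv`
    apply (localPiEquiv L (IsCMField.complexConj L) N H' w).injective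
    have hl : (localPiEquiv L (IsCMField.complexConj L) N H' w) ((finAdelicEquiv (↥(maximalRealSubfield L)) L (IsCMField.complexConj L) N H') (e'.symm (((adelicStableCentralizerEquiv L hH hH' hc hreg) x : (Subgroup.centralizer ({((cmDatum L N H').toAdelic γ')} : Set (cmDatum L N H').Adelic))) : (cmDatum L N H').Adelic)).2 w) =
        (cmDatum L N H').toLocal w (((adelicStableCentralizerEquiv L hH hH' hc hreg) x : (Subgroup.centralizer ({((cmDatum L N H').toAdelic γ')} : Set (cmDatum L N H').Adelic))) : (cmDatum L N H').Adelic) := by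
      rw [hes2']; exact (cmDatum_toLocal_eq_localPiEquiv L H' w _).symm
    rw [hl, hP, toLocal_adelicStableCentralizerEquiv L hH hH' hc hreg w (hregv w) x]
    congr 2
    apply Subtype.ext
    rw [hQ₁]
    change (cmDatum L N H).toLocal w (x : (cmDatum L N H).Adelic) = (localPiEquiv L (IsCMField.complexConj L) N H w) ((finAdelicEquiv (↥(maximalRealSubfield L)) L (IsCMField.complexConj L) N H) (e.symm (x : (cmDatum L N H).Adelic)).2 w)
    rw [hes2]
    exact cmDatum_toLocal_eq_localPiEquiv L H w _

end Coherence

section Covolume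

variable {γ : (cmDatum L N H).Rational} {γ' : (cmDatum L N H').Rational}
  [MeasurableSpace (cmDatum L N H).Adelic] [BorelSpace (cmDatum L N H).Adelic]
  [MeasurableSpace (cmDatum L N H').Adelic] [BorelSpace (cmDatum L N H').Adelic]

/-- **(b2) Stably conjugate regular `γ ↔ γ′` have the same weight `m(Z_γ(L⁺) \ Z_γ(𝔸))`** once their adelic torus measures are coherent
(`(e_𝔸)_* t_𝔸 = t′_𝔸`, ★ `map_adelicStableCentralizerEquiv_torusMeasure_eq`): the covolumes of `U(H)(L⁺) ∩ Z(γ ⊗ 1)` in `Z(γ ⊗ 1)` and of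
`U(H′)(L⁺) ∩ Z(γ′ ⊗ 1)` in `Z(γ′ ⊗ 1)` (counting measure on the lattice, the currency of ★ `integral_quotientKernel_diag_eq_mul_tsum_covol_cmDatum`)
agree — ★ `covolume_count_eq_of_mulEquiv'` along `e_𝔸`, which carries the one lattice onto the other (★ `adelicStableCentralizerEquiv_mem_arithmeticSubgroup_iff`).
[cite: Rogawski1990, §14.5 pp. 237–238] [cite: Gelbart1975, Remark 9.23] -/
theorem covolume_eq_of_map_adelicStableCentralizerEquiv_eq (hH : H.det ≠ 0) (hH' : H'.det ≠ 0)
    (hc : Corresponds (cmConjRingHom L) H H' γ γ') (hreg : IsRegularElt (γ.val : GL (Fin N) L))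
    [hZ : IsClosed (((Subgroup.centralizer ({((cmDatum L N H).toAdelic γ)} : Set (cmDatum L N H).Adelic)) : Subgroup (cmDatum L N H).Adelic) : Set (cmDatum L N H).Adelic)]
    [hZ' : IsClosed (((Subgroup.centralizer ({((cmDatum L N H').toAdelic γ')} : Set (cmDatum L N H').Adelic)) : Subgroup (cmDatum L N H').Adelic) : Set (cmDatum L N H').Adelic)]
    [hΓ : IsClosed (((((cmDatum L N H).quotientSubgroup ⊓ (Subgroup.centralizer ({((cmDatum L N H).toAdelic γ)} : Set (cmDatum L N H).Adelic))).subgroupOf (Subgroup.centralizer ({((cmDatum L N H).toAdelic γ)} : Set (cmDatum L N H).Adelic))) : Subgroup (Subgroup.centralizer ({((cmDatum L N H).toAdelic γ)} : Set (cmDatum L N H).Adelic))) : Set (Subgroup.centralizer ({((cmDatum L N H).toAdelic γ)} : Set (cmDatum L N H).Adelic)))]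
    [hΓ' : IsClosed (((((cmDatum L N H').quotientSubgroup ⊓ (Subgroup.centralizer ({((cmDatum L N H').toAdelic γ')} : Set (cmDatum L N H').Adelic))).subgroupOf (Subgroup.centralizer ({((cmDatum L N H').toAdelic γ')} : Set (cmDatum L N H').Adelic))) : Subgroup (Subgroup.centralizer ({((cmDatum L N H').toAdelic γ')} : Set (cmDatum L N H').Adelic))) : Set (Subgroup.centralizer ({((cmDatum L N H').toAdelic γ')} : Set (cmDatum L N H').Adelic)))]
    [MeasurableSpace ((Subgroup.centralizer ({((cmDatum L N H).toAdelic γ)} : Set (cmDatum L N H).Adelic)) ⧸ (((cmDatum L N H).quotientSubgroup ⊓ (Subgroup.centralizer ({((cmDatum L N H).toAdelic γ)} : Set (cmDatum L N H).Adelic))).subgroupOf (Subgroup.centralizer ({((cmDatum L N H).toAdelic γ)} : Set (cmDatum L N H).Adelic))))] [BorelSpace ((Subgroup.centralizer ({((cmDatum L N H).toAdelic γ)} : Set (cmDatum L N H).Adelic)) ⧸ (((cmDatum L N H).quotientSubgroup ⊓ (Subgroup.centralizer ({((cmDatum L N H).toAdelic γ)} : Set (cmDatum L N H).Adelic))).subgroupOf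 (Subgroup.centralizer ({((cmDatum L N H).toAdelic γ)} : Set (cmDatum L N H).Adelic))))]
    [MeasurableSpace ((Subgroup.centralizer ({((cmDatum L N H').toAdelic γ')} : Set (cmDatum L N H').Adelic)) ⧸ (((cmDatum L N H').quotientSubgroup ⊓ (Subgroup.centralizer ({((cmDatum L N H').toAdelic γ')} : Set (cmDatum L N H').Adelic))).subgroupOf (Subgroup.centralizer ({((cmDatum L N H').toAdelic γ')} : Set (cmDatum L N H').Adelic))))] [BorelSpace ((Subgroup.centralizer ({((cmDatum L N H').toAdelic γ')} : Set (cmDatum L N H').Adelic)) ⧸ (((cmDatum L N H').quotientSubgroup ⊓ (Subgroup.centralizer ({((cmDatum L N H').toAdelic γ')} : Set (cmDatum L N H').Adelic))).subgroupOf (Subgroup.centralizer ({((cmDatum L N H').toAdelic γ')} : Set (cmDatum L N H').Adelic))))]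
    [MeasurableSingletonClass (((cmDatum L N H).quotientSubgroup ⊓ (Subgroup.centralizer ({((cmDatum L N H).toAdelic γ)} : Set (cmDatum L N H).Adelic))).subgroupOf (Subgroup.centralizer ({((cmDatum L N H).toAdelic γ)} : Set (cmDatum L N H).Adelic)))] [MeasurableSingletonClass (((cmDatum L N H').quotientSubgroup ⊓ (Subgroup.centralizer ({((cmDatum L N H').toAdelic γ')} : Set (cmDatum L N H').Adelic))).subgroupOf (Subgroup.centralizer ({((cmDatum L N H').toAdelic γ')} : Set (cmDatum L N H').Adelic)))]
    [(count : Measure (((cmDatum L N H).quotientSubgroup ⊓ (Subgroup.centralizer ({((cmDatum L N H).toAdelic γ)} : Set (cmDatum L N H).Adelic))).subgroupOf (Subgroup.centralizer ({((cmDatum L N H).toAdelic γ)} : Set (cmDatum L N H).Adelic)))).IsMulLeftInvariant] [IsFiniteMeasureOnCompacts (count : Measure (((cmDatum L N H).quotientSubgroup ⊓ (Subgroup.centralizer ({((cmDatum L N H).toAdelic γ)} : Set (cmDatum L N H).Adelic))).subgroupOf (Subgroup.centralizer ({((cmDatum L N H).toAdelic γ)} : Set (cmDatum L N H).Adelic)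)))]
    [(count : Measure (((cmDatum L N H).quotientSubgroup ⊓ (Subgroup.centralizer ({((cmDatum L N H).toAdelic γ)} : Set (cmDatum L N H).Adelic))).subgroupOf (Subgroup.centralizer ({((cmDatum L N H).toAdelic γ)} : Set (cmDatum L N H).Adelic)))).IsOpenPosMeasure] [(count : Measure (((cmDatum L N H).quotientSubgroup ⊓ (Subgroup.centralizer ({((cmDatum L N H).toAdelic γ)} : Set (cmDatum L N H).Adelic))).subgroupOf (Subgroup.centralizer ({((cmDatum L N H).toAdelic γ)} : Set (cmDatum L N H).Adelic)))).IsInvInvariant] [SFinite (count : Measure (((cmDatum L N H).quotientSubgroup ⊓ (Subgroup.centralizer ({((cmDatum L N H).toAdelic γ)} : Set (cmDatum L N H).Adelic))).subgroupOf (Subgroup.centralizer ({((cmDatum L N H).toAdelic γ)} : Set (cmDatum L N H).Adelic))))]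
    [(count : Measure (((cmDatum L N H').quotientSubgroup ⊓ (Subgroup.centralizer ({((cmDatum L N H').toAdelic γ')} : Set (cmDatum L N H').Adelic))).subgroupOf (Subgroup.centralizer ({((cmDatum L N H').toAdelic γ')} : Set (cmDatum L N H').Adelic)))).IsMulLeftInvariant] [IsFiniteMeasureOnCompacts (count : Measure (((cmDatum L N H').quotientSubgroup ⊓ (Subgroup.centralizer ({((cmDatum L N H').toAdelic γ')} : Set (cmDatum L N H').Adelic))).subgroupOf (Subgroup.centralizer ({((cmDatum L N H').toAdelic γ')} : Set (cmDatum L N H').Adelic))))]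
    [(count : Measure (((cmDatum L N H').quotientSubgroup ⊓ (Subgroup.centralizer ({((cmDatum L N H').toAdelic γ')} : Set (cmDatum L N H').Adelic))).subgroupOf (Subgroup.centralizer ({((cmDatum L N H').toAdelic γ')} : Set (cmDatum L N H').Adelic)))).IsOpenPosMeasure] [(count : Measure (((cmDatum L N H').quotientSubgroup ⊓ (Subgroup.centralizer ({((cmDatum L N H').toAdelic γ')} : Set (cmDatum L N H').Adelic))).subgroupOf (Subgroup.centralizer ({((cmDatum L N H').toAdelic γ')} : Set (cmDatum L N H').Adelic)))).IsInvInvariant] [SFinite (count : Measure (((cmDatum L N H').quotientSubgroup ⊓ (Subgroup.centralizer ({((cmDatum L N H').toAdelic γ')} : Set (cmDatum L N H').Adelic))).subgroupOf (Subgroup.centralizer ({((cmDatum L N H').toAdelic γ')} : Set (cmDatum L N H').Adelic))))]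
    (tA : Measure (Subgroup.centralizer ({((cmDatum L N H).toAdelic γ)} : Set (cmDatum L N H).Adelic))) [IsHaarMeasure tA] [tA.IsMulRightInvariant]
    (tA' : Measure (Subgroup.centralizer ({((cmDatum L N H').toAdelic γ')} : Set (cmDatum L N H').Adelic))) [IsHaarMeasure tA'] [tA'.IsMulRightInvariant]
    (h : Measure.map (adelicStableCentralizerEquiv L hH hH' hc hreg) tA = tA') :
    quotientMeasure (((cmDatum L N H).quotientSubgroup ⊓ (Subgroup.centralizer ({((cmDatum L N H).toAdelic γ)} : Set (cmDatum L N H).Adelic))).subgroupOf (Subgroup.centralizer ({((cmDatum L N H).toAdelic γ)} : Set (cmDatum L N H).Adelic))) (count : Measure (((cmDatum L N H).quotientSubgroup ⊓ (Subgroup.centralizer ({((cmDatum L N H).toAdelic γ)} : Set (cmDatum L N H).Adelic))).subgroupOf (Subgroup.centralizer ({((cmDatum L N H).toAdelic γ)} : Set (cmDatum L N H).Adelic)))) hΓ tA Set.univ = quotientMeasure (((cmDatum L N H').quotientSubgroup ⊓ (Subgroup.centralizer ({((cmDatum L N H').toAdelic γ')} : Set (cmDatum L N H').Adelic))).subgroupOf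 (Subgroup.centralizer ({((cmDatum L N H').toAdelic γ')} : Set (cmDatum L N H').Adelic))) (count : Measure (((cmDatum L N H').quotientSubgroup ⊓ (Subgroup.centralizer ({((cmDatum L N H').toAdelic γ')} : Set (cmDatum L N H').Adelic))).subgroupOf (Subgroup.centralizer ({((cmDatum L N H').toAdelic γ')} : Set (cmDatum L N H').Adelic)))) hΓ' tA' Set.univ := by
  haveI : LocallyCompactSpace (Subgroup.centralizer ({((cmDatum L N H).toAdelic γ)} : Set (cmDatum L N H).Adelic)) := hZ.isClosedEmbedding_subtypeVal.locallyCompactSpace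
  haveI : LocallyCompactSpace (Subgroup.centralizer ({((cmDatum L N H').toAdelic γ')} : Set (cmDatum L N H').Adelic)) := hZ'.isClosedEmbedding_subtypeVal.locallyCompactSpace
  refine covolume_count_eq_of_mulEquiv' (adelicStableCentralizerEquiv L hH hH' hc hreg).toMulEquiv (adelicStableCentralizerEquiv L hH hH' hc hreg).continuous (adelicStableCentralizerEquiv L hH hH' hc hreg).symm.continuous (((cmDatum L N H).quotientSubgroup ⊓ (Subgroup.centralizer ({((cmDatum L N H).toAdelic γ)} : Set (cmDatum L N H).Adelic))).subgroupOf (Subgroup.centralizer ({((cmDatum L N H).toAdelic γ)} : Set (cmDatum L N H).Adelic))) (((cmDatum L N H').quotientSubgroup ⊓ (Subgroup.centralizer ({((cmDatum L N H').toAdelic γ')} : Set (cmDatum L N H').Adelic))).subgroupOf (Subgroup.centralizer ({((cmDatum L N H').toAdelic γ')} : Set (cmDatum L N H').Adelic))) (fun z => ?_) tA tA' h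
  have hz := adelicStableCentralizerEquiv_mem_arithmeticSubgroup_iff L hH hH' hc hreg z
  rw [Subgroup.mem_subgroupOf, Subgroup.mem_subgroupOf] at hz
  change (adelicStableCentralizerEquiv L hH hH' hc hreg) z ∈ (((cmDatum L N H').quotientSubgroup ⊓ (Subgroup.centralizer ({((cmDatum L N H').toAdelic γ')} : Set (cmDatum L N H').Adelic))).subgroupOf (Subgroup.centralizer ({((cmDatum L N H').toAdelic γ')} : Set (cmDatum L N H').Adelic))) ↔ z ∈ (((cmDatum L N H).quotientSubgroup ⊓ (Subgroup.centralizer ({((cmDatum L N H).toAdelic γ)} : Set (cmDatum L N H).Adelic))).subgroupOf (Subgroup.centralizer ({((cmDatum L N H).toAdelic γ)} : Set (cmDatum L N H).Adelic)))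
  rw [Subgroup.mem_subgroupOf, Subgroup.mem_subgroupOf, Subgroup.mem_inf, Subgroup.mem_inf, cmDatum_quotientSubgroup, cmDatum_quotientSubgroup,
    ← cmDatum_arithmeticSubgroup, ← cmDatum_arithmeticSubgroup]
  exact ⟨fun h' => ⟨hz.1 h'.1, z.2⟩, fun h' => ⟨hz.2 h'.1, ((adelicStableCentralizerEquiv L hH hH' hc hreg) z).2⟩⟩

end Covolume

end UnitaryGroup

end Literature.NumberTheory.Automorphic
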